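import Mathlib
import Summits.NavierStokesRegularity.NavierStokesRegularity.Theorems.FilamentSkeletonRssClause13ModelPieceEstimate
import Summits.NavierStokesRegularity.NavierStokesRegularity.Theorems.FilamentSkeletonRssClause13ModelSymbolWindows

/-!
# Clause 13-J/13-R, brick n3 LAYER C (ELLIPTIC-WINDOW PIECE): for a cut-off piece `P = k∗Y` whose profile lives where the symbol is one-signed of
# size `≥ κ`:  `G·κ·‖P‖₂² ≤ (‖k‖₁‖𝓛Y‖₂ + C_k·‖Y‖₂ + √2Λ‖k′‖₁·‖(τ−c)Y‖₂)·‖k‖₁‖Y‖₂`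

Route `FilamentSkeletonRss`, ∃-side clause 13 (`Clause13RNearStraightL` stmt-NavierStokesRegularity-23612; typing-agnostic); design
`filament-plan/DESIGN-28296-model-gluing-g16-v2-addendum.md` §A/§C (pieces S1 and MID; task C2/C3).  Inputs: the generic window estimate
`model_window_estimate` (p700344), the piece–operator bound `l2_pieceOperator_le` (p700907), Layer B (p699582, p699990, p700576), the transform of a
convolution `unnormalisedTransform_conv` (p698858).  Everything about the kernel enters through five numbers (`‖k‖₁, ‖t k‖₁, ‖k′‖₁, ‖t k′‖₁` and the
profile `χ(z) = ∫k e^{izt}`):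

* §1 `piece_deriv_eq_derivKernel_piece` — `∫k(x−y)Y′(y)dy = ∫k′(x−y)Y(y)dy` (`Y ∈ C¹_c`): the derivative of a piece sits on the KERNEL, so
  `‖(τ−c)P′‖₂ ≤ √2(‖k′‖₁‖(τ−c)Y‖₂ + ‖t k′‖₁‖Y‖₂)` (`l2_weight_pieceDeriv_le`);
* §2 `memLp_modelSelf_piece` — `M_qP ∈ L²` (via `K_q∗(k∗Y) = k∗(K_q∗Y)`);
* §3 `transform_piece_eq_zero` — `P̂(z) = χ(z)Ŷ(z)`, so `P̂ = 0` off the support of `χ`;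
* §4 `model_piece_window_estimate` — the estimate of the title, for `χ` supported where `(2/q)𝔖(z√q) ≤ −κ` (S1-type) or `≥ κ` (MID-type).
Lane ns-filament-19175-p1 g16; `--supports stmt-NavierStokesRegularity-23612 --as helper`.
HONEST FRAMING: bookkeeping about an explicit 1-D model operator attached to a HYPOTHETICAL filament skeleton on the NEGATIVE side of a MODEL route;
nothing here bears on Navier–Stokes regularity or blow-up.
-/

noncomputable section

open MeasureTheory Real Complex Filter Set
open scoped ComplexConjugate Topology
open Summit.NavierStokesRegularity.NavierStokesRegularity.Theorems.AnalyticStripLiaSymbol (liaSym)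

namespace Summit.NavierStokesRegularity.NavierStokesRegularity.Theorems.MatchedKernel
set_option linter.dupNamespace false

/-! ## §1 The derivative of a piece sits on the kernel -/

/-- **`∫k(x−y)Y′(y)dy = ∫k′(x−y)Y(y)dy`** for `k ∈ C¹` (continuous `k′`) and `Y ∈ C¹_c` (integration by parts; no boundary terms). [folklore] -/
theorem piece_deriv_eq_derivKernel_piece {k k' : ℝ → ℝ} (hk : ∀ t, HasDerivAt k (k' t) t) (hk'c : Continuous k')
    {Y : ℝ → ℂ} (hY : ContDiff ℝ 1 Y) (hYs : HasCompactSupport Y) (x : ℝ) :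
    ∫ y : ℝ, ((k (x - y) : ℝ) : ℂ) * deriv Y y = ∫ y : ℝ, ((k' (x - y) : ℝ) : ℂ) * Y y := by
  have hkc : Continuous k := continuous_iff_continuousAt.2 fun t => (hk t).continuousAt
  have hYc := hY.continuous
  have hY'c : Continuous (deriv Y) := hY.continuous_deriv le_rfl
  have hYd : ∀ y, HasDerivAt Y (deriv Y y) y := fun y => (hY.differentiable one_ne_zero y).hasDerivAt
  have hsub : Continuous fun y : ℝ => x - y := continuous_const.sub continuous_id
  -- `d/dy [k(x−y) Y(y)] = −k′(x−y)Y(y) + k(x−y)Y′(y)`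
  have hprod : ∀ y, HasDerivAt (fun y => ((k (x - y) : ℝ) : ℂ) * Y y)
      (((-k' (x - y) : ℝ) : ℂ) * Y y + ((k (x - y) : ℝ) : ℂ) * deriv Y y) y := by
    intro y
    have h1 : HasDerivAt (fun y => k (x - y)) (-k' (x - y)) y := by
      have h := (hk (x - y)).comp y ((hasDerivAt_id y).const_sub x)
      have h' : HasDerivAt (fun y => k (x - y)) (k' (x - y) * -1) y := h
      exact h'.congr_deriv (by ring)
    exact (h1.ofReal_comp).mul (hYd y)
  have hI1 : Integrable (fun y => ((-k' (x - y) : ℝ) : ℂ) * Y y) :=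
    ((Complex.continuous_ofReal.comp (hk'c.comp hsub).neg).mul hYc).integrable_of_hasCompactSupport hYs.mul_left
  have hI2 : Integrable (fun y => ((k (x - y) : ℝ) : ℂ) * deriv Y y) :=
    ((Complex.continuous_ofReal.comp (hkc.comp hsub)).mul hY'c).integrable_of_hasCompactSupport hYs.deriv.mul_left
  have hI0 : Integrable (fun y => ((k (x - y) : ℝ) : ℂ) * Y y) :=
    ((Complex.continuous_ofReal.comp (hkc.comp hsub)).mul hYc).integrable_of_hasCompactSupport hYs.mul_left
  have hzero := integral_eq_zero_of_hasDerivAt_of_integrable hprod (hI1.add hI2) hI0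
  rw [integral_add hI1 hI2] at hzero
  have e : ∫ y : ℝ, ((-k' (x - y) : ℝ) : ℂ) * Y y = -∫ y : ℝ, ((k' (x - y) : ℝ) : ℂ) * Y y := by
    rw [← integral_neg]
    refine integral_congr_ae (ae_of_all _ fun y => ?_); push_cast; ring
  rw [e] at hzero
  linear_combination hzero

/-- **`‖(τ−c)P′‖₂ ≤ √2·(‖k′‖₁‖(τ−c)Y‖₂ + ‖t k′‖₁‖Y‖₂)`** and `(τ−c)P′ ∈ L²`, where `P′(x) = ∫k(x−y)Y′(y)dy`. [folklore] -/
theorem l2_weight_pieceDeriv_le {k k' : ℝ → ℝ} (hk : ∀ t, HasDerivAt k (k' t) t) (hk'c : Continuous k') (hk'i : Integrable k')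
    (hk'1 : Integrable fun t => t * k' t) {Y : ℝ → ℂ} (hY : ContDiff ℝ 1 Y) (hYs : HasCompactSupport Y) (c : ℝ) :
    MemLp (fun x : ℝ => (((x - c : ℝ) : ℂ)) * ∫ y : ℝ, ((k (x - y) : ℝ) : ℂ) * deriv Y y) 2 volume ∧
      (∫ x : ℝ, ‖(((x - c : ℝ) : ℂ)) * ∫ y : ℝ, ((k (x - y) : ℝ) : ℂ) * deriv Y y‖ ^ 2) ^ (1 / 2 : ℝ)
        ≤ Real.sqrt 2 * ((∫ t, |k' t|) * (∫ y : ℝ, ‖(((y - c : ℝ) : ℂ)) * Y y‖ ^ 2) ^ (1 / 2 : ℝ)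
          + (∫ t, |t| * |k' t|) * (∫ y : ℝ, ‖Y y‖ ^ 2) ^ (1 / 2 : ℝ)) := by
  have hYc := hY.continuous
  have ept : ∀ x : ℝ, ∫ y : ℝ, ((k (x - y) : ℝ) : ℂ) * deriv Y y = ∫ y : ℝ, ((k' (x - y) : ℝ) : ℂ) * Y y :=
    fun x => piece_deriv_eq_derivKernel_piece hk hk'c hY hYs x
  simp_rw [ept]
  obtain ⟨hmem, hle⟩ := integral_sq_norm_weight_piece_le hk'c hk'i hk'1 hYc hYs c
  refine ⟨hmem, ?_⟩
  have h0 : 0 ≤ ∫ y : ℝ, ‖(((y - c : ℝ) : ℂ)) * Y y‖ ^ 2 := integral_nonneg fun y => by positivity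
  have h1 : 0 ≤ ∫ y : ℝ, ‖Y y‖ ^ 2 := integral_nonneg fun y => by positivity
  have hA : 0 ≤ ∫ t, |k' t| := integral_nonneg fun t => abs_nonneg _
  have hB : 0 ≤ ∫ t, |t| * |k' t| := integral_nonneg fun t => by positivity
  set a : ℝ := (∫ t, |k' t|) * (∫ y : ℝ, ‖(((y - c : ℝ) : ℂ)) * Y y‖ ^ 2) ^ (1 / 2 : ℝ) with ha
  set b : ℝ := (∫ t, |t| * |k' t|) * (∫ y : ℝ, ‖Y y‖ ^ 2) ^ (1 / 2 : ℝ) with hb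
  have ha0 : 0 ≤ a := by positivity
  have hb0 : 0 ≤ b := by positivity
  have ha2 : a ^ 2 = (∫ t, |k' t|) ^ 2 * ∫ y : ℝ, ‖(((y - c : ℝ) : ℂ)) * Y y‖ ^ 2 := by
    rw [ha, mul_pow, ← Real.rpow_natCast ((∫ y : ℝ, ‖(((y - c : ℝ) : ℂ)) * Y y‖ ^ 2) ^ (1 / 2 : ℝ)) 2, ← Real.rpow_mul h0]
    norm_num
  have hb2 : b ^ 2 = (∫ t, |t| * |k' t|) ^ 2 * ∫ y : ℝ, ‖Y y‖ ^ 2 := by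
    rw [hb, mul_pow, ← Real.rpow_natCast ((∫ y : ℝ, ‖Y y‖ ^ 2) ^ (1 / 2 : ℝ)) 2, ← Real.rpow_mul h1]
    norm_num
  -- `LHS² ≤ 2a² + 2b² ≤ (√2 (a+b))²`
  have hI0 : 0 ≤ ∫ x : ℝ, ‖(((x - c : ℝ) : ℂ)) * ∫ y : ℝ, ((k' (x - y) : ℝ) : ℂ) * Y y‖ ^ 2 := integral_nonneg fun x => by positivity
  have hsq : ∫ x : ℝ, ‖(((x - c : ℝ) : ℂ)) * ∫ y : ℝ, ((k' (x - y) : ℝ) : ℂ) * Y y‖ ^ 2 ≤ (Real.sqrt 2 * (a + b)) ^ 2 := by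
    rw [mul_pow, Real.sq_sqrt (by norm_num)]
    nlinarith [hle, ha2, hb2, mul_nonneg ha0 hb0]
  calc (∫ x : ℝ, ‖(((x - c : ℝ) : ℂ)) * ∫ y : ℝ, ((k' (x - y) : ℝ) : ℂ) * Y y‖ ^ 2) ^ (1 / 2 : ℝ)
      ≤ ((Real.sqrt 2 * (a + b)) ^ 2) ^ (1 / 2 : ℝ) := Real.rpow_le_rpow hI0 hsq (by norm_num)
    _ = Real.sqrt 2 * (a + b) := by
        rw [← Real.sqrt_eq_rpow, Real.sqrt_sq (by positivity)]

/-! ## §2 `M_qP ∈ L²` for a piece -/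

/-- `M_q(k∗Y) = (2/q)(k∗Y) − K_q∗(k∗Y) ∈ L²` for a bounded integrable continuous real kernel and `Y ∈ C_c`. [folklore] -/
theorem memLp_modelSelf_piece {q : ℝ} (hq : 0 < q) {k : ℝ → ℝ} (hkc : Continuous k) (hki : Integrable k) {Mk : ℝ} (hkM : ∀ t, |k t| ≤ Mk)
    {Y : ℝ → ℂ} (hYc : Continuous Y) (hYs : HasCompactSupport Y) :
    MemLp (fun τ : ℝ => (2 / q : ℂ) * (∫ y : ℝ, ((k (τ - y) : ℝ) : ℂ) * Y y)
      - ∫ σ : ℝ, ((((2 * q - (τ - σ) ^ 2) * (((τ - σ) ^ 2 + q) ^ (5 / 2 : ℝ))⁻¹ : ℝ)) : ℂ) * ∫ y : ℝ, ((k (σ - y) : ℝ) : ℂ) * Y y) 2 volume := by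
  have hP2 := memLp_piece hkc hki hYc hYs
  -- `K_q∗(k∗Y) = k∗(K_q∗Y)` pointwise, and the latter is in `L²`
  set F : ℝ → ℂ := fun y => ∫ σ : ℝ, ((((2 * q - (y - σ) ^ 2) * (((y - σ) ^ 2 + q) ^ (5 / 2 : ℝ))⁻¹ : ℝ)) : ℂ) * Y σ with hF
  have hFc : Continuous F := continuous_smoothingPiece hq hYc hYs
  have hF2 : MemLp F 2 volume := memLp_piece (k := fun s => (2 * q - s ^ 2) * ((s ^ 2 + q) ^ (5 / 2 : ℝ))⁻¹) (continuous_smoothingKernel hq)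
    (integrable_smoothingKernel_real hq) hYc hYs
  obtain ⟨hkF2, _⟩ := l2_kernel_mul_le hkc hki hFc hF2 (fun y => norm_smoothingPiece_le hq hYc hYs y)
  have hcomm : (fun τ : ℝ => ∫ σ : ℝ, ((((2 * q - (τ - σ) ^ 2) * (((τ - σ) ^ 2 + q) ^ (5 / 2 : ℝ))⁻¹ : ℝ)) : ℂ) * ∫ y : ℝ, ((k (σ - y) : ℝ) : ℂ) * Y y)
      = fun τ : ℝ => ∫ y : ℝ, ((k (τ - y) : ℝ) : ℂ) * F y := by
    funext τ
    exact conv_conv_comm (K := fun s => (2 * q - s ^ 2) * ((s ^ 2 + q) ^ (5 / 2 : ℝ))⁻¹) (continuous_smoothingKernel hq)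
      (integrable_smoothingKernel_real hq) (fun t => abs_smoothingKernel_le_const hq t) hkc hki hkM hYc hYs τ
  have h := (hP2.const_mul (2 / q : ℂ)).sub hkF2
  refine h.ae_eq (ae_of_all _ fun τ => ?_)
  simp only [Pi.sub_apply]
  rw [congrFun hcomm τ]

/-! ## §3 The transform of a piece vanishes off the profile's support -/

/-- If `∫k e^{izt} = χ(z)` then `P̂(z) = χ(z)Ŷ(z)`; in particular `P̂(z) ≠ 0 ⟹ χ(z) ≠ 0`. [folklore] -/
theorem transform_piece_ne_zero {k : ℝ → ℝ} (hki : Integrable k) {χ : ℝ → ℂ} (hkχ : ∀ z : ℝ, ∫ t : ℝ, ((k t : ℝ) : ℂ) * cexp (I * z * t) = χ z)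
    {Y : ℝ → ℂ} (hYi : Integrable Y) (z : ℝ)
    (hz : (∫ x : ℝ, (∫ y : ℝ, ((k (x - y) : ℝ) : ℂ) * Y y) * cexp (I * z * x)) ≠ 0) : χ z ≠ 0 := by
  have h := unnormalisedTransform_conv (k := fun t => ((k t : ℝ) : ℂ)) hki.ofReal hYi z
  beta_reduce at h
  rw [h, hkχ z] at hz
  exact left_ne_zero_of_mul hz

/-! ## §4 The elliptic-window piece estimate -/

/-- **ELLIPTIC-WINDOW PIECE ESTIMATE.**  `q, G > 0`, `κ : ℝ`; `k` real `C¹`, bounded, with `k, k′, t k, t k′ ∈ L¹` and profile `χ(z) = ∫k e^{izt}`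
supported where the symbol is one-signed of size `≥ κ` (`χ z ≠ 0 → (2/q)𝔖(z√q) ≤ −κ`, or `… ≥ κ`); `Y ∈ C¹_c`; `w` differentiable, `w(c) = 0`,
`|w′| ≤ Λ`; `β_i` continuous, `‖β_i‖ ≤ b_i`, `‖β_i(y)−β_i(x)‖ ≤ L_i|y−x|`.  With `P = k∗Y`:
`G·κ·∫‖P‖² ≤ (‖k‖₁·N(𝓛Y) + (Λ(‖t k′‖₁+‖k‖₁) + (L₁+L₂)‖t k‖₁ + (b₁+b₂)‖k‖₁ + √2Λ‖t k′‖₁)·N(Y) + √2Λ‖k′‖₁·N((τ−c)Y))·‖k‖₁·N(Y)`,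
`N(f) = (∫‖f‖²)^{1/2}`. [folklore] -/
theorem model_piece_window_estimate {q G κ : ℝ} (hq : 0 < q) (hG : 0 < G)
    {k k' : ℝ → ℝ} (hk : ∀ t, HasDerivAt k (k' t) t) (hk'c : Continuous k') (hki : Integrable k) (hk'i : Integrable k')
    (hk1 : Integrable fun t => t * k t) (hk'1 : Integrable fun t => t * k' t) {Mk : ℝ} (hkM : ∀ t, |k t| ≤ Mk)
    {χ : ℝ → ℂ} (hkχ : ∀ z : ℝ, ∫ t : ℝ, ((k t : ℝ) : ℂ) * cexp (I * z * t) = χ z)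
    (hsym : (∀ z : ℝ, χ z ≠ 0 → 2 / q * liaSym (z * √q) ≤ -κ) ∨ (∀ z : ℝ, χ z ≠ 0 → κ ≤ 2 / q * liaSym (z * √q)))
    {Y : ℝ → ℂ} (hY : ContDiff ℝ 1 Y) (hYs : HasCompactSupport Y) (c : ℝ)
    {w : ℝ → ℝ} (hw : Differentiable ℝ w) {Λ : ℝ} (hΛ : ∀ t, |deriv w t| ≤ Λ) (hwc : w c = 0)
    {β₁ β₂ : ℝ → ℂ} (hβ₁c : Continuous β₁) (hβ₂c : Continuous β₂) {b₁ b₂ L₁ L₂ : ℝ}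
    (hb₁ : ∀ τ, ‖β₁ τ‖ ≤ b₁) (hb₂ : ∀ τ, ‖β₂ τ‖ ≤ b₂) (hL₁ : ∀ x y, ‖β₁ y - β₁ x‖ ≤ L₁ * |y - x|) (hL₂ : ∀ x y, ‖β₂ y - β₂ x‖ ≤ L₂ * |y - x|) :
    G * κ * ∫ x : ℝ, ‖∫ y : ℝ, ((k (x - y) : ℝ) : ℂ) * Y y‖ ^ 2
      ≤ ((∫ t, |k t|) * (∫ y : ℝ, ‖I * (G : ℂ) * ((2 / q : ℂ) * Y y
              - ∫ σ : ℝ, ((((2 * q - (y - σ) ^ 2) * (((y - σ) ^ 2 + q) ^ (5 / 2 : ℝ))⁻¹ : ℝ)) : ℂ) * Y σ)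
            - ((w y : ℝ) : ℂ) * deriv Y y + β₁ y * Y y + β₂ y * conj (Y y)‖ ^ 2) ^ (1 / 2 : ℝ)
          + (Λ * ((∫ t, |t| * |k' t|) + ∫ t, |k t|) + (L₁ + L₂) * (∫ t, |t| * |k t|) + (b₁ + b₂) * (∫ t, |k t|)
              + Real.sqrt 2 * Λ * ∫ t, |t| * |k' t|) * (∫ y : ℝ, ‖Y y‖ ^ 2) ^ (1 / 2 : ℝ)
          + Real.sqrt 2 * Λ * (∫ t, |k' t|) * (∫ y : ℝ, ‖(((y - c : ℝ) : ℂ)) * Y y‖ ^ 2) ^ (1 / 2 : ℝ))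
        * ((∫ t, |k t|) * (∫ y : ℝ, ‖Y y‖ ^ 2) ^ (1 / 2 : ℝ)) := by
  have hkc : Continuous k := continuous_iff_continuousAt.2 fun t => (hk t).continuousAt
  have hYc := hY.continuous
  have hY'c : Continuous (deriv Y) := hY.continuous_deriv le_rfl
  have hΛ0 : 0 ≤ Λ := (abs_nonneg _).trans (hΛ 0)
  -- the piece and its derivative
  set P : ℝ → ℂ := fun x => ∫ y : ℝ, ((k (x - y) : ℝ) : ℂ) * Y y with hP
  set P' : ℝ → ℂ := fun x => ∫ y : ℝ, ((k (x - y) : ℝ) : ℂ) * deriv Y y with hP'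
  have hP1 : Integrable P := integrable_piece hki hYc hYs
  have hP2 : MemLp P 2 volume := memLp_piece hkc hki hYc hYs
  have hP'c : Continuous P' := continuous_piece hkc hY'c hYs.deriv
  obtain ⟨hwP'2, hwP'le⟩ := l2_weight_pieceDeriv_le hk hk'c hk'i hk'1 hY hYs c
  have hM2 := memLp_modelSelf_piece hq hkc hki hkM hYc hYs
  -- symbol hypothesis for `P`
  have hsymP : (∀ z : ℝ, (∫ x : ℝ, P x * cexp (I * z * x)) ≠ 0 → 2 / q * liaSym (z * √q) ≤ -κ) ∨
      (∀ z : ℝ, (∫ x : ℝ, P x * cexp (I * z * x)) ≠ 0 → κ ≤ 2 / q * liaSym (z * √q)) := by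
    rcases hsym with h | h
    · exact Or.inl fun z hz => h z (transform_piece_ne_zero hki hkχ (hYc.integrable_of_hasCompactSupport hYs) z hz)
    · exact Or.inr fun z hz => h z (transform_piece_ne_zero hki hkχ (hYc.integrable_of_hasCompactSupport hYs) z hz)
  -- the generic window estimate for `P`
  have hwin := model_window_estimate (Y := P) (Y' := P') hq hG hP1 hP2 hP'c.aestronglyMeasurable c hwP'2 hM2 hsymP hw hΛ hwc
    hβ₁c.aestronglyMeasurable hβ₂c.aestronglyMeasurable hb₁ hb₂
  -- bound the three factors
  have hL := l2_pieceOperator_le (G := G) hq hk hk'c hki hk1 hk'1 hkM hY hYs hw hΛ hβ₁c hβ₂c hb₁ hb₂ hL₁ hL₂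
  obtain ⟨_, hPle⟩ := integral_sq_norm_piece_le hkc hki hYc hYs
  have hNP : (∫ x, ‖P x‖ ^ 2) ^ (1 / 2 : ℝ) ≤ (∫ t, |k t|) * (∫ y : ℝ, ‖Y y‖ ^ 2) ^ (1 / 2 : ℝ) :=
    l2_le_of_sq_le (integral_nonneg fun t => abs_nonneg _) hPle
  have hb0 : 0 ≤ b₁ + b₂ := add_nonneg ((norm_nonneg _).trans (hb₁ 0)) ((norm_nonneg _).trans (hb₂ 0))
  have hNY : 0 ≤ (∫ y : ℝ, ‖Y y‖ ^ 2) ^ (1 / 2 : ℝ) := by positivity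
  have hNW : 0 ≤ (∫ y : ℝ, ‖(((y - c : ℝ) : ℂ)) * Y y‖ ^ 2) ^ (1 / 2 : ℝ) := by positivity
  have hk0 : 0 ≤ ∫ t, |k t| := integral_nonneg fun t => abs_nonneg _
  have hk10 : 0 ≤ ∫ t, |t| * |k t| := integral_nonneg fun t => by positivity
  have hk'0 : 0 ≤ ∫ t, |k' t| := integral_nonneg fun t => abs_nonneg _
  have hk'10 : 0 ≤ ∫ t, |t| * |k' t| := integral_nonneg fun t => by positivity
  have hL10 : 0 ≤ L₁ := by have := hL₁ 0 1; rw [sub_zero, abs_one, mul_one] at this; exact (norm_nonneg _).trans this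
  have hL20 : 0 ≤ L₂ := by have := hL₂ 0 1; rw [sub_zero, abs_one, mul_one] at this; exact (norm_nonneg _).trans this
  have hNL : 0 ≤ (∫ y : ℝ, ‖I * (G : ℂ) * ((2 / q : ℂ) * Y y
              - ∫ σ : ℝ, ((((2 * q - (y - σ) ^ 2) * (((y - σ) ^ 2 + q) ^ (5 / 2 : ℝ))⁻¹ : ℝ)) : ℂ) * Y σ)
            - ((w y : ℝ) : ℂ) * deriv Y y + β₁ y * Y y + β₂ y * conj (Y y)‖ ^ 2) ^ (1 / 2 : ℝ) := by positivity
  refine hwin.trans ?_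
  have hfac1 := add_le_add (add_le_add hL (mul_le_mul_of_nonneg_left hwP'le hΛ0)) (mul_le_mul_of_nonneg_left hNP hb0)
  refine (mul_le_mul hfac1 hNP (by positivity) ?_).trans (le_of_eq ?_)
  · positivity
  · ring

end Summit.NavierStokesRegularity.NavierStokesRegularity.Theorems.MatchedKernel

end
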